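import Mathlib.Algebra.Order.Field.Basic
import Mathlib.Tactic.Ring
import Mathlib.Tactic.Linarith
import Mathlib.Tactic.LinearCombination
import Summits.Ventures.CertifiedArithmetic.LowPrec.SRAccumulation
import HarnessLib

/-!
# Stochastic rounding into a finite format: affine RECURSIONS, I — the exact mean

HONEST FRAMING: certified error envelopes and provably optimal rounding/accumulation schemes for
low-precision formats under stated cost models; every table by two implementations; no hardware or
vendor claims.

Venture CertifiedArithmetic / lowprec, SR slice (R3), generation 10, file 1 of 3 on RECURSIONS. Files
`SRStep`/`SRAccumulation`/`SREnvelopes` treat recursive SUMMATION `ŝ ← SR(ŝ + x)`. The canonical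
machine-learning uses of SR are, however, general state UPDATES `x ← SR(g(x))`: the exponential moving
average / momentum buffer `m ← SR(β m + (1−β) g)`, `axpy`-type updates `w ← SR(w − η v)`, geometric
decay `x ← SR(a x)`, running products. This file sets up the exact finite-format theory of such
recursions (a fresh saturating mode-2 SR at every step) and proves the MEAN theorems:

* `recExp F g n f s = E[f(xₙ)]` for `x₀ = s`, `xₖ₊₁ = SR_F(g k xₖ)` — the backward recursion over the
  binary outcome tree (exact in `K`, computable, `decide`-evaluable); `accExp` of file II is the case
  `g k t = t + x k` (`accExp_eq_recExp`); linear, monotone;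
* `PreAll F g n P s` — "every pre-rounding value on every branch satisfies `P`" (Boolean evaluator,
  decidable), with the instances `NoSatR` (no branch saturates; UNDERFLOW into the subnormal range or
  to `0` is allowed — it is inside the hull) and `GapLER G` (candidate gaps `≤ G` on every branch);
* for AFFINE updates `affMap a b k t = a k · t + b k` with exact (unrounded) trajectory `affMean` and
  total gain `affGain = ∏ a k`:
  `recExp_affMap_id` — **unconditional mean decomposition** `E[xₙ] = mₙ + recBias`, `recBias` the
  gain-weighted expected saturation defect (saturation is the ONLY source of bias);
  `recExp_affMap_id_of_noSatR` — **`E[xₙ] = mₙ` exactly** when no branch saturates: SR commutes with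
  affine dynamics in the mean, in every finite format, through subnormals, at ties, for contracting or
  expanding gains; `recExp_scale_id_of_noSatR` (product/decay chains: `E[xₙ] = (∏ a k)·x₀`);
  `recExp_ema_const` — the SR-EMA of a constant signal has `E[xₙ] = μ + βⁿ(x₀ − μ)`: geometric
  convergence of the mean from ANY start, no dead band (round-to-nearest recursions stall on a dead
  band of half-width `[0.5/(1−|a|)]` grid units, [Jackson1996] eq. (11.5.1); exact RN dead-band
  statements and format instances: file 3, `SRRecursionFormats`).

File 2 (`SRRecursionVariance`): the exact variance identity with squared downstream gains, the window
envelope and the n-free STATIONARY bound `Var[xₙ] ≤ G²/(4(1−β²))` for contractions.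

References: [ConnollyHighamMary2021] Lemma 4.4/4.5 (mean, mean independence), Thm 4.13;
[CrociGiles2022] Lemma 4.1, §3.3 (SR errors of linear parabolic time-stepping are zero-mean and
mean-independent; RtN stagnates for small `Δt`) — the nearest prior art: real-arithmetic model
`fl(x) = x(1+δ)`, no finite format, no saturation, no exact identity; [KieburtzLawrenceMina1977]
(randomised quantisation suppresses limit cycles of recursive digital filters); [Jackson1996] §11.5
(dead band of `y(n) = x(n) + a·y(n−1)` under rounding); [CrociEtAl2022] §6–7 (SR in ODE/PDE solvers
and neural-network training, stagnation); [OzkaraYuPark2025] §2 (SR weight updates as a random walk;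
stagnation of RN updates).
-/

namespace Summit.Ventures.CertifiedArithmetic.LowPrec.SR

open Literature.ComputerArithmetic.ConnollyHighamMary2021
open Finset

variable {K : Type*} [Field K] [LinearOrder K] [IsStrictOrderedRing K]

/-! ### General recursions `xₖ₊₁ = SR(g k xₖ)`: the backward recursion -/

/-- `recExp F g n f s = E[f(xₙ)]` for `x₀ = s`, `xₖ₊₁ = SR_F(g k xₖ)` (saturating mode-2 SR into `F`,
a fresh rounding at every step; `g k` is the `k`-th update map, `g k xₖ` the pre-rounding value). -/
def recExp (F : Finset K) : (ℕ → K → K) → ℕ → (K → K) → K → K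
  | _, 0, f, s => f s
  | g, n + 1, f, s => step F (g 0 s) (recExp F (fun i => g (i + 1)) n f)

omit [IsStrictOrderedRing K] in
/-- Recursive summation (file II) is the recursion with update maps `t ↦ t + x k`. -/
theorem accExp_eq_recExp (F : Finset K) (x : ℕ → K) (n : ℕ) (f : K → K) (s : K) :
    accExp F x n f s = recExp F (fun k t => t + x k) n f s := by
  induction n generalizing x s with
  | zero => rfl
  | succ n ih =>
      simp only [accExp, recExp]
      congr 1
      funext t
      exact ih _ _

omit [IsStrictOrderedRing K] in
/-- Total mass one. -/
theorem recExp_const (F : Finset K) (g : ℕ → K → K) (n : ℕ) (a s : K) :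
    recExp F g n (fun _ => a) s = a := by
  induction n generalizing g s with
  | zero => rfl
  | succ n ih =>
      simp only [recExp]
      rw [show recExp F (fun i => g (i + 1)) n (fun _ => a) = fun _ => a from funext (ih _), step_const]

omit [IsStrictOrderedRing K] in
/-- Linearity: additivity. -/
theorem recExp_add (F : Finset K) (g : ℕ → K → K) (n : ℕ) (f h : K → K) (s : K) :
    recExp F g n (fun t => f t + h t) s = recExp F g n f s + recExp F g n h s := by
  induction n generalizing g s with
  | zero => rfl
  | succ n ih =>
      simp only [recExp]
      rw [← step_add]
      exact step_congr F _ (ih _ _) (ih _ _)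

omit [IsStrictOrderedRing K] in
/-- Linearity: scalars. -/
theorem recExp_mul_left (F : Finset K) (g : ℕ → K → K) (n : ℕ) (a : K) (f : K → K) (s : K) :
    recExp F g n (fun t => a * f t) s = a * recExp F g n f s := by
  induction n generalizing g s with
  | zero => rfl
  | succ n ih =>
      simp only [recExp]
      rw [← step_mul_left]
      exact step_congr F _ (ih _ _) (ih _ _)

/-- Monotonicity. -/
theorem recExp_mono (F : Finset K) (g : ℕ → K → K) (n : ℕ) {f h : K → K} (hfh : ∀ t, f t ≤ h t)
    (s : K) : recExp F g n f s ≤ recExp F g n h s := by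
  induction n generalizing g s with
  | zero => exact hfh s
  | succ n ih => simp only [recExp]; exact step_mono F _ (fun t => ih _ t)

/-- Positivity. -/
theorem recExp_nonneg (F : Finset K) (g : ℕ → K → K) (n : ℕ) {f : K → K} (hf : ∀ t, 0 ≤ f t)
    (s : K) : 0 ≤ recExp F g n f s := by
  have := recExp_mono F g n (f := fun _ => (0 : K)) (h := f) hf s
  rwa [recExp_const] at this

omit [IsStrictOrderedRing K] in
/-- `recExp` respects pointwise equality of integrands. -/
theorem recExp_congr (F : Finset K) (g : ℕ → K → K) (n : ℕ) {f h : K → K} (hfh : ∀ t, f t = h t)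
    (s : K) : recExp F g n f s = recExp F g n h s := by
  rw [show f = h from funext hfh]

/-! ### Path predicates on the pre-rounding values -/

/-- `PreAll F g n P s`: every pre-rounding value `g k xₖ` on every branch of the outcome tree
satisfies `P`. -/
def PreAll (F : Finset K) : (ℕ → K → K) → ℕ → (K → Prop) → K → Prop
  | _, 0, _, _ => True
  | g, n + 1, P, s => P (g 0 s) ∧ PreAll F (fun i => g (i + 1)) n P (up F (g 0 s))
      ∧ PreAll F (fun i => g (i + 1)) n P (dn F (g 0 s))

/-- Boolean evaluator of `PreAll` for a decidable predicate (clean kernel reduction for `decide`). -/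
def preAllB (F : Finset K) (P : K → Prop) [DecidablePred P] : (ℕ → K → K) → ℕ → K → Bool
  | _, 0, _ => true
  | g, n + 1, s => decide (P (g 0 s)) && preAllB F P (fun i => g (i + 1)) n (up F (g 0 s))
      && preAllB F P (fun i => g (i + 1)) n (dn F (g 0 s))

omit [Field K] [IsStrictOrderedRing K] in
/-- `preAllB` computes `PreAll`. -/
theorem preAllB_iff (F : Finset K) (P : K → Prop) [DecidablePred P] (g : ℕ → K → K) (n : ℕ)
    (s : K) : preAllB F P g n s = true ↔ PreAll F g n P s := by
  induction n generalizing g s with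
  | zero => simp [preAllB, PreAll]
  | succ n ih => simp [preAllB, PreAll, ih, Bool.and_eq_true, and_assoc]

/-- `PreAll` is decidable for a decidable predicate (via `preAllB`). -/
instance instDecidablePreAll (F : Finset K) (P : K → Prop) [DecidablePred P] (g : ℕ → K → K)
    (n : ℕ) (s : K) : Decidable (PreAll F g n P s) :=
  decidable_of_iff _ (preAllB_iff F P g n s)

omit [Field K] [IsStrictOrderedRing K] in
/-- `PreAll` is monotone in the predicate. -/
theorem preAll_mono (F : Finset K) (g : ℕ → K → K) (n : ℕ) {P Q : K → Prop} (hPQ : ∀ c, P c → Q c)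
    (s : K) (h : PreAll F g n P s) : PreAll F g n Q s := by
  induction n generalizing g s with
  | zero => trivial
  | succ n ih =>
      obtain ⟨h0, hu, hd⟩ := h
      exact ⟨hPQ _ h0, ih _ _ hu, ih _ _ hd⟩

omit [Field K] [IsStrictOrderedRing K] in
/-- A predicate true everywhere holds along every branch. -/
theorem preAll_of_forall (F : Finset K) (g : ℕ → K → K) (n : ℕ) {P : K → Prop} (hP : ∀ c, P c)
    (s : K) : PreAll F g n P s := by
  induction n generalizing g s with
  | zero => trivial
  | succ n ih => exact ⟨hP _, ih _ _, ih _ _⟩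

omit [Field K] [IsStrictOrderedRing K] in
/-- Conjunction of path predicates. -/
theorem preAll_and (F : Finset K) (g : ℕ → K → K) (n : ℕ) {P Q : K → Prop} (s : K)
    (hP : PreAll F g n P s) (hQ : PreAll F g n Q s) : PreAll F g n (fun c => P c ∧ Q c) s := by
  induction n generalizing g s with
  | zero => trivial
  | succ n ih =>
      obtain ⟨p0, pu, pd⟩ := hP
      obtain ⟨q0, qu, qd⟩ := hQ
      exact ⟨⟨p0, q0⟩, ih _ _ pu qu, ih _ _ pd qd⟩

/-- `NoSatR F g n s`: no pre-rounding value on any branch leaves the hull `[min F, max F]`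
(underflow into the subnormal range or to `0` is allowed — it is inside the hull). -/
def NoSatR (F : Finset K) (g : ℕ → K → K) (n : ℕ) (s : K) : Prop := PreAll F g n (InHull F) s

/-- `GapLER F G g n s`: every (clamped) pre-rounding value on every branch has candidate gap
`⌈c̄⌉ − ⌊c̄⌋ ≤ G`. -/
def GapLER (F : Finset K) (G : K) (g : ℕ → K → K) (n : ℕ) (s : K) : Prop :=
  PreAll F g n (fun c => roundUp F (clamp F c) - roundDown F (clamp F c) ≤ G) s

/-- `NoSatR` is decidable. -/
instance instDecidableNoSatR (F : Finset K) (g : ℕ → K → K) (n : ℕ) (s : K) :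
    Decidable (NoSatR F g n s) := by
  unfold NoSatR; infer_instance

/-- `GapLER` is decidable. -/
instance instDecidableGapLER (F : Finset K) (G : K) (g : ℕ → K → K) (n : ℕ) (s : K) :
    Decidable (GapLER F G g n s) := by
  unfold GapLER; infer_instance

omit [IsStrictOrderedRing K] in
/-- `GapLER G` on every branch from a gap bound valid on the whole hull (e.g. the top-binade spacing
of a format). -/
theorem gapLER_of_hull {F : Finset K} (hF : F.Nonempty) {G : K}
    (hgap : ∀ c, InHull F c → roundUp F c - roundDown F c ≤ G) (g : ℕ → K → K) (n : ℕ) (s : K) :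
    GapLER F G g n s :=
  preAll_of_forall F g n (fun c => hgap _ (clamp_inHull hF c)) s

/-! ### Affine update maps: exact trajectory, gains, bias and variance functionals -/

/-- The affine update maps `t ↦ a k · t + b k` (EMA/momentum: `a k = β`, `b k = (1−β)·gₖ`; axpy:
`a k = 1`; geometric decay / running product: `b k = 0`). -/
def affMap (a b : ℕ → K) : ℕ → K → K := fun k t => a k * t + b k

omit [LinearOrder K] [IsStrictOrderedRing K] in
/-- Shifting the affine maps. -/
theorem affMap_succ (a b : ℕ → K) :
    (fun i => affMap a b (i + 1)) = affMap (fun i => a (i + 1)) (fun i => b (i + 1)) := rfl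

omit [LinearOrder K] [IsStrictOrderedRing K] in
/-- Evaluation of an affine map. -/
theorem affMap_apply (a b : ℕ → K) (k : ℕ) (t : K) : affMap a b k t = a k * t + b k := rfl

/-- Total gain `∏_{k<n} a k` (peeling index `0` first). -/
def affGain (a : ℕ → K) : ℕ → K
  | 0 => 1
  | n + 1 => affGain (fun i => a (i + 1)) n * a 0

/-- The EXACT (unrounded) trajectory `m₀ = s`, `mₖ₊₁ = a k · mₖ + b k`, as a function of the start. -/
def affMean (a b : ℕ → K) : ℕ → K → K
  | 0, s => s
  | n + 1, s => affMean (fun i => a (i + 1)) (fun i => b (i + 1)) n (a 0 * s + b 0)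

/-- Expected gain-weighted cumulative saturation defect `∑ₖ A_{k+1} E[clamp(cₖ) − cₖ]`. -/
def recBias (F : Finset K) : (ℕ → K) → (ℕ → K) → ℕ → K → K
  | _, _, 0, _ => 0
  | a, b, n + 1, s => affGain (fun i => a (i + 1)) n * (clamp F (a 0 * s + b 0) - (a 0 * s + b 0))
      + step F (a 0 * s + b 0) (recBias F (fun i => a (i + 1)) (fun i => b (i + 1)) n)

omit [LinearOrder K] [IsStrictOrderedRing K] in
/-- The exact trajectory is affine in the start with slope the total gain. -/
theorem affMean_eq (a b : ℕ → K) (n : ℕ) (s : K) :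
    affMean a b n s = affGain a n * s + affMean a b n 0 := by
  induction n generalizing a b s with
  | zero => simp [affMean, affGain]
  | succ n ih =>
      simp only [affMean, affGain, mul_zero, zero_add]
      rw [ih _ _ (a 0 * s + b 0), ih _ _ (b 0)]
      ring

omit [LinearOrder K] [IsStrictOrderedRing K] in
/-- A pure product chain (`b = 0`) has exact trajectory `(∏ a k)·s`. -/
theorem affMean_zero (a : ℕ → K) (n : ℕ) (s : K) :
    affMean a (fun _ => 0) n s = affGain a n * s := by
  induction n generalizing a s with
  | zero => simp [affMean, affGain]
  | succ n ih =>
      simp only [affMean, affGain, add_zero]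
      rw [ih]
      ring

omit [LinearOrder K] [IsStrictOrderedRing K] in
/-- EMA of a constant signal `μ` with rate `β`: exact trajectory `μ + βⁿ(s − μ)`. -/
theorem affMean_ema_const (β μ : K) (n : ℕ) (s : K) :
    affMean (fun _ => β) (fun _ => (1 - β) * μ) n s = μ + β ^ n * (s - μ) := by
  induction n generalizing s with
  | zero => simp [affMean]
  | succ n ih =>
      simp only [affMean]
      rw [ih, pow_succ]
      ring

/-! ### One step against affine and quadratic-of-affine test functions -/

omit [IsStrictOrderedRing K] in
/-- `E[A·SR(c) + B] = A·clamp(c) + B`. -/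
theorem step_linear (F : Finset K) (c A B : K) :
    step F c (fun t => A * t + B) = A * clamp F c + B := by
  rw [step_add F c (fun t => A * t) (fun _ => B), step_mul_left, step_id, step_const]

/-! ### Mean: exact decomposition; unbiasedness without saturation -/

omit [IsStrictOrderedRing K] in
/-- **Mean decomposition (unconditional).** `E[xₙ] = mₙ + recBias`: for affine updates the only
source of bias of SR into a finite format is saturation (overflow clamping), weighted by the
downstream gains. -/
theorem recExp_affMap_id (F : Finset K) (a b : ℕ → K) (n : ℕ) (s : K) :
    recExp F (affMap a b) n (fun t => t) s = affMean a b n s + recBias F a b n s := by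
  induction n generalizing a b s with
  | zero => simp [recExp, affMean, recBias]
  | succ n ih =>
      simp only [recExp, affMap_succ, affMean, recBias]
      have hfun : recExp F (affMap (fun i => a (i + 1)) (fun i => b (i + 1))) n (fun t => t)
          = fun t => (affGain (fun i => a (i + 1)) n * t
              + affMean (fun i => a (i + 1)) (fun i => b (i + 1)) n 0)
              + recBias F (fun i => a (i + 1)) (fun i => b (i + 1)) n t := by
        funext t
        rw [ih, affMean_eq]
      rw [hfun, step_add F _ (fun t => affGain (fun i => a (i + 1)) n * t
          + affMean (fun i => a (i + 1)) (fun i => b (i + 1)) n 0)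
        (recBias F (fun i => a (i + 1)) (fun i => b (i + 1)) n), step_linear,
        affMean_eq (fun i => a (i + 1)) (fun i => b (i + 1)) n (a 0 * s + b 0), affMap_apply]
      ring

omit [IsStrictOrderedRing K] in
/-- Without a saturating branch the expected saturation defect vanishes. -/
theorem recBias_eq_zero_of_noSatR (F : Finset K) (a b : ℕ → K) (n : ℕ) (s : K)
    (h : NoSatR F (affMap a b) n s) : recBias F a b n s = 0 := by
  induction n generalizing a b s with
  | zero => rfl
  | succ n ih =>
      obtain ⟨hc, hu, hd⟩ := h
      simp only [affMap_succ, affMap_apply] at hc hu hd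
      simp only [recBias]
      rw [clamp_eq_self hc, sub_self, mul_zero, zero_add]
      rw [step_congr F _ (g := fun _ => (0 : K)) (ih _ _ _ hu) (ih _ _ _ hd), step_const]

omit [IsStrictOrderedRing K] in
/-- **SR commutes with affine dynamics in the mean.** If no branch saturates, `E[xₙ] = mₙ`, the exact
unrounded trajectory — for every finite format, through the subnormal range, at ties, for any gains
(contracting or expanding) and offsets. -/
theorem recExp_affMap_id_of_noSatR (F : Finset K) (a b : ℕ → K) (n : ℕ) (s : K)
    (h : NoSatR F (affMap a b) n s) : recExp F (affMap a b) n (fun t => t) s = affMean a b n s := by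
  rw [recExp_affMap_id, recBias_eq_zero_of_noSatR F a b n s h, add_zero]

omit [IsStrictOrderedRing K] in
/-- Product / decay chains `xₖ₊₁ = SR(a k · xₖ)`: `E[xₙ] = (∏ a k)·s` without saturation. -/
theorem recExp_scale_id_of_noSatR (F : Finset K) (a : ℕ → K) (n : ℕ) (s : K)
    (h : NoSatR F (affMap a fun _ => 0) n s) :
    recExp F (affMap a fun _ => 0) n (fun t => t) s = affGain a n * s := by
  rw [recExp_affMap_id_of_noSatR F a _ n s h, affMean_zero]

omit [IsStrictOrderedRing K] in
/-- **EMA of a constant signal under SR**: `E[xₙ] = μ + βⁿ(x₀ − μ)` exactly (no saturation) — the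
mean converges geometrically to `μ` from ANY start; there is no dead band. -/
theorem recExp_ema_const (F : Finset K) (β μ : K) (n : ℕ) (s : K)
    (h : NoSatR F (affMap (fun _ => β) fun _ => (1 - β) * μ) n s) :
    recExp F (affMap (fun _ => β) fun _ => (1 - β) * μ) n (fun t => t) s = μ + β ^ n * (s - μ) := by
  rw [recExp_affMap_id_of_noSatR F _ _ n s h, affMean_ema_const]

end Summit.Ventures.CertifiedArithmetic.LowPrec.SR
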